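import Literature.MathematicalPhysics.QuantumFieldTheory.Balaban1983to89.B16Ineq19NearFlatSlice

/-!
# `Balaban1983to89.B16Ineq19NearFlatSliceBox` — [Balaban1989LargeFieldII] p. 357 «doing a proper gauge transformation we represent it on the domain Z as exp iξA₀, with A₀ satisfying
# the bound |A₀|, |∇A₀| < O(1)M⁶R_kε_k» READ INTO (1.7): THE JUNCTION (J-c) → (S5) — a bond-wise near-flatness letter on the torus image of the integer box `[lo − 1, hi + 2]`
# (`T4AxialGaugeSmallField.boxBonds`, the output shape of the small-field axial gauge of the background) FEEDS the support-local near-flat (1.7) ∕ `h17` of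
# `B16Ineq19NearFlatSlice` for the slice of the box `Λ^{(k)} = castSite″[lo, hi]`: every plaquette meeting a free bond of the chart has its four bonds in that box

Honest framing: statement-level skeleton of published theorems with citation tags; proofs where landed; nothing here is a claim about the Yang–Mills mass gap.

Cell `pub-ymgap` (HUMAN RULINGS D-0062 ∕ D-0149), WIDTH SEAT `pub-ymgap-dag-n12-w2` generation 2 (node N12 = [B15]; key K1⁷ `stmt-QuantumFields-20542`, `--kind proof --supports …`; count-neutral);
file 3 of the successor piece (S5).  The PRODUCER of the letter is dag-n12-c g16's NAMED JUNCTION (J-c) (INBOX 2026-08-28 l.26361), taken by dag-n13-w2 (INTENT-9 l.26569,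
`Thm/BalabanUVNodesN12SmallFieldAxialGaugeOfBackground`: `∃ u a₀, IsGaugeOn (box) u ∧ U^u = expMul su2Chart a₀ 1 ∧ ∀ b ∈ boxBonds lo hi, dist1 (U^u b) ≤ (d−1)·n·δ`); this file is the
CONSUMER-SIDE geometry only and restates nothing of it.

WHAT THIS FILE PROVES (theorems only; no `def`, no `instance`, no `sorry`; axioms standard).
§1 THE PLAQUETTE NEIGHBOURHOOD OF THE BOX: `eq_castSite_sub_e_of_shift_eq` (`x + e_μ = castSite z ⇒ x = castSite (z − e_μ)`), ★ `exists_src_eq_castSite_of_corner_mem` (a plaquette with a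
   CORNER in `castSite″[lo, hi]` is based at `castSite z′`, `lo − 1 ≤ z′ ≤ hi`), ★ `plaq_bonds_mem_boxBonds` (then its four bonds lie in `boxBonds (lo − 1) (hi + 2)`),
   ★★ `nearFlat_local_hyp_of_boxBonds` (a bond-wise letter `‖U_b − 1‖ ≤ δ` on `boxBonds (lo − 1) (hi + 2)` gives the support-local hypothesis of `B16Ineq19NearFlatSlice` for the
   free bonds of ANY tree `T` over `S = castSite″[lo, hi]`), `nearFlat_local_hyp_of_boxBonds_dist1` (the same from `dist1 (U b) ≤ δ`, pub-balaban's
   `T4ExpWindowSmallField.dist1_eq_norm_coe_sub_one` BY NAME).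
§2 ★★★ `h17_nearFlat_sliceFn_of_boxBonds` ∕ `h17_nearFlat_sliceFn_of_boxBonds_dist1` — THE N12 CHAIN'S `h17` (`B15Prop1OneSidedIneq17Edition` :395 with `f := wilsonAction4`, k-level
   bare-action currency, `γ₀ = 1`, `Cerr = 64(d−1)δ`) FROM A `boxBonds (lo − 1) (hi + 2)` NEAR-FLATNESS LETTER of the background; `curlSq_sub_le_secondVariation_nearFlat_of_boxBonds`
   (the ray form, any non-wrapping window).

HONEST SCOPE — what is NOT claimed.  Elementary torus bookkeeping (`castSite`, `Site.shift`); the letter `‖U_b − 1‖ ≤ δ` on the box is a HYPOTHESIS here (produced, for the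
gauge-transformed background `U^u`, by (J-c) — dag-n13-w2; which background the N12 endpoint feeds (`ext i V_k` in the shell gauge of [IV] p. 193) is the assembler's reading, not
this file's); k-level ∕ un-averaged currency as in `B16Ineq19NearFlatSlice`; `SU(2)` only.  Count-neutral; N12 NOT discharged (5∕27 unmoved); finite 𝕋⁴ at fixed ε; R4 closes only the
conditional rung `BalabanLadder.UV` — the Yang–Mills mass gap (Clay) is NOT proved by any of this; nothing continuum ∕ ℝ⁴ ∕ OS.  CONSUMED BY NAME: `B16Ineq19NearFlatSlice.{h17_nearFlat_sliceFn_local,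
curlSq_sub_le_secondVariation_nearFlat_local}` (this seat), `T4AxialGaugeSmallField.{castSite, castSite_add_e, boxBonds}`, `T4ExpWindowSmallField.dist1_eq_norm_coe_sub_one`, `B7Prop1Explicit.{e, e_apply}`, dag-n12-c
`B15Prop1SliceCoordinates.{GaugeSlice, ιA, freeBonds, mem_freeBonds}` ∕ `B15DeterminingSets.bondsOf`.  0 kit, 0 lit wants.

## References
* [Balaban1989LargeFieldII] T. Bałaban, Commun. Math. Phys. 122 (1989) 355–392: p. 357 (the gauge `exp iξA₀` on `Z`), (1.7)–(1.9) p. 358, p. 359 (the gauge condition `B′↾_{G₀} = 0`).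
* [Balaban1989LargeFieldI] T. Bałaban, Commun. Math. Phys. 122 (1989) 175–202: (1.74) p. 192, p. 193 (the axial gauge around `Λ`).
* [Balaban1985Averaging] T. Bałaban, Commun. Math. Phys. 98 (1985) 17–51: (5) p. 18 (bonds, plaquettes), (19) p. 21 (`|U − 1|`).
-/

noncomputable section

open Set

namespace Literature.MathematicalPhysics.QuantumFieldTheory.Balaban1983to89.B16Ineq19NearFlatSliceBox

open GaugeField
open T4CubeChartGnomonic (SU2)
open T4AxialGaugeSmallField (castSite castSite_add_e boxBonds)
open B7Prop1Explicit (e e_apply)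
open B15DeterminingSets (bondsOf)
open B15Prop1SliceCoordinates (GaugeSlice ιA freeBonds mem_freeBonds)
open B15Prop1SliceTaylorCalculus (sliceFn rGrad)
open B16Sect1Backgrounds (expMul)
open B15Prop1ChartSU2 (su2Chart)
open B6TreeGaugePoincare (curl)
open B16Eq18Proof (box)
open B16Ineq19NearFlatSlice (h17_nearFlat_sliceFn_local curlSq_sub_le_secondVariation_nearFlat_local)
open T4ExpWindowSmallField (dist1_eq_norm_coe_sub_one)
open scoped Matrix.Norms.L2Operator

variable {P : Params} {k : ℕ}

/-! ## §1  The plaquette neighbourhood of the box `castSite″[lo, hi]`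
(The two spellings of the letter (19) — (J-c)'s `dist1` and the U2a files' `‖↑W − 1‖_op` — agree by pub-balaban's `T4ExpWindowSmallField.dist1_eq_norm_coe_sub_one`, CITED, not restated.) -/

/-- `(x + e_μ) − e_μ = x` on the torus. [folklore] -/
private theorem unshift_shift' (x : Site P k) (μ : Fin P.d) : (x.shift μ).unshift μ = x := by
  funext ν
  by_cases h : ν = μ
  · subst h; simp [Site.shift, Site.unshift]
  · simp [Site.shift, Site.unshift, Function.update_of_ne h]

/-- **ONE STEP BACK ALONG THE PROJECTION**: if `x + e_μ = castSite z` then `x = castSite (z − e_μ)` (`castSite_add_e` and injectivity of the shift). [cite: Balaban1985Averaging, (5) p.18 (bookkeeping)] -/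
theorem eq_castSite_sub_e_of_shift_eq {x : Site P k} {z : Fin P.d → ℤ} {μ : Fin P.d} (h : x.shift μ = castSite z) :
    x = castSite (z - e μ) := by
  have h2 : (castSite (z - e μ) : Site P k).shift μ = x.shift μ := by
    rw [← castSite_add_e, sub_add_cancel, h]
  have h3 := congrArg (fun y : Site P k => y.unshift μ) h2
  simp only [unshift_shift'] at h3
  exact h3.symm

/-- Componentwise bookkeeping: `lo ≤ z ≤ hi ⇒ lo − 1 ≤ z − e_μ ≤ hi`. [folklore] -/
private theorem sub_e_bounds {lo hi z : Fin P.d → ℤ} (hz : lo ≤ z ∧ z ≤ hi) (μ : Fin P.d) : lo - 1 ≤ z - e μ ∧ z - e μ ≤ hi := by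
  refine ⟨fun i => ?_, fun i => ?_⟩
  · have h1 : lo i ≤ z i := hz.1 i
    simp only [Pi.sub_apply, Pi.one_apply, e_apply]
    split_ifs <;> omega
  · have h2 : z i ≤ hi i := hz.2 i
    simp only [Pi.sub_apply, e_apply]
    split_ifs <;> omega

/-- Componentwise bookkeeping for two distinct directions: `lo ≤ z ≤ hi`, `μ ≠ ν ⇒ lo − 1 ≤ z − e_ν − e_μ ≤ hi`. [folklore] -/
private theorem sub_e_sub_e_bounds {lo hi z : Fin P.d → ℤ} (hz : lo ≤ z ∧ z ≤ hi) {μ ν : Fin P.d} (hμν : μ ≠ ν) :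
    lo - 1 ≤ z - e ν - e μ ∧ z - e ν - e μ ≤ hi := by
  refine ⟨fun i => ?_, fun i => ?_⟩
  · have h1 : lo i ≤ z i := hz.1 i
    simp only [Pi.sub_apply, Pi.one_apply, e_apply]
    split_ifs with hi1 hi2 <;> omega
  · have h2 : z i ≤ hi i := hz.2 i
    simp only [Pi.sub_apply, e_apply]
    split_ifs <;> omega

/-- ★ **A PLAQUETTE WITH A CORNER IN THE BOX IS BASED NEXT TO IT**: if one of the four corners `x, x+e_μ, x+e_ν, x+e_μ+e_ν` (the last in either order of the steps) of `p = ⟨x, μ<ν⟩` lies in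
`castSite″[lo, hi]`, then `x = castSite z′` with `lo − 1 ≤ z′ ≤ hi`. [cite: Balaban1985Averaging, (5) p.18 (bookkeeping); Balaban1989LargeFieldII, p.359] -/
theorem exists_src_eq_castSite_of_corner_mem {lo hi : Fin P.d → ℤ} (p : Plaq P k)
    (h : p.src ∈ (castSite '' Set.Icc lo hi : Set (Site P k)) ∨ p.src.shift p.μ ∈ (castSite '' Set.Icc lo hi : Set (Site P k))
      ∨ p.src.shift p.ν ∈ (castSite '' Set.Icc lo hi : Set (Site P k)) ∨ (p.src.shift p.μ).shift p.ν ∈ (castSite '' Set.Icc lo hi : Set (Site P k))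
      ∨ (p.src.shift p.ν).shift p.μ ∈ (castSite '' Set.Icc lo hi : Set (Site P k))) :
    ∃ z' : Fin P.d → ℤ, p.src = castSite z' ∧ lo - 1 ≤ z' ∧ z' ≤ hi := by
  have hμν : p.μ ≠ p.ν := ne_of_lt p.hμν
  rcases h with ⟨z, hz, hzx⟩ | ⟨z, hz, hzx⟩ | ⟨z, hz, hzx⟩ | ⟨z, hz, hzx⟩ | ⟨z, hz, hzx⟩
  · refine ⟨z, hzx.symm, fun i => ?_, hz.2⟩
    have h1 : lo i ≤ z i := hz.1 i
    simp only [Pi.sub_apply, Pi.one_apply]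
    omega
  · exact ⟨z - e p.μ, eq_castSite_sub_e_of_shift_eq hzx.symm, sub_e_bounds hz p.μ⟩
  · exact ⟨z - e p.ν, eq_castSite_sub_e_of_shift_eq hzx.symm, sub_e_bounds hz p.ν⟩
  · have h1 : p.src.shift p.μ = castSite (z - e p.ν) := eq_castSite_sub_e_of_shift_eq hzx.symm
    exact ⟨z - e p.ν - e p.μ, eq_castSite_sub_e_of_shift_eq h1, sub_e_sub_e_bounds hz hμν⟩
  · have h1 : p.src.shift p.ν = castSite (z - e p.μ) := eq_castSite_sub_e_of_shift_eq hzx.symm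
    refine ⟨z - e p.μ - e p.ν, eq_castSite_sub_e_of_shift_eq h1, sub_e_sub_e_bounds hz hμν.symm⟩

/-- ★ **THE FOUR BONDS OF A PLAQUETTE BASED NEXT TO THE BOX LIE IN `boxBonds (lo − 1) (hi + 2)`**: if `p.src = castSite z′` with `lo − 1 ≤ z′ ≤ hi`, then `⟨x,μ⟩, ⟨x+e_μ,ν⟩, ⟨x+e_ν,μ⟩, ⟨x,ν⟩`
all belong to `T4AxialGaugeSmallField.boxBonds (lo − 1) (hi + 2)` (integer representatives `z′`, `z′ + e_μ`, `z′ + e_ν`, `z′`). [cite: Balaban1985Averaging, (5) p.18 (bookkeeping); Balaban1989LargeFieldII, p.357] -/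
theorem plaq_bonds_mem_boxBonds {lo hi : Fin P.d → ℤ} (p : Plaq P k) (z' : Fin P.d → ℤ) (hsrc : p.src = castSite z') (hlo : lo - 1 ≤ z') (hhi : z' ≤ hi) :
    (⟨p.src, p.μ⟩ : PBond P k) ∈ boxBonds (lo - 1) (hi + 2) ∧ (⟨p.src.shift p.μ, p.ν⟩ : PBond P k) ∈ boxBonds (lo - 1) (hi + 2)
      ∧ (⟨p.src.shift p.ν, p.μ⟩ : PBond P k) ∈ boxBonds (lo - 1) (hi + 2) ∧ (⟨p.src, p.ν⟩ : PBond P k) ∈ boxBonds (lo - 1) (hi + 2) := by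
  have hb1 : ∀ μ : Fin P.d, z' + e μ ≤ hi + 2 := fun μ i => by
    have h2 : z' i ≤ hi i := hhi i
    simp only [Pi.add_apply, e_apply, Pi.ofNat_apply]
    split_ifs <;> omega
  have hb2 : ∀ μ ν : Fin P.d, lo - 1 ≤ z' + e μ ∧ z' + e μ + e ν ≤ hi + 2 := fun μ ν => by
    refine ⟨fun i => ?_, fun i => ?_⟩
    · have h1 : (lo - 1) i ≤ z' i := hlo i
      simp only [Pi.add_apply, Pi.sub_apply, Pi.one_apply, e_apply] at h1 ⊢
      split_ifs <;> omega
    · have h2 : z' i ≤ hi i := hhi i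
      simp only [Pi.add_apply, e_apply, Pi.ofNat_apply]
      split_ifs <;> omega
  refine ⟨⟨z', hlo, hb1 p.μ, hsrc⟩, ⟨z' + e p.μ, (hb2 p.μ p.ν).1, (hb2 p.μ p.ν).2, ?_⟩, ⟨z' + e p.ν, (hb2 p.ν p.μ).1, (hb2 p.ν p.μ).2, ?_⟩, ⟨z', hlo, hb1 p.ν, hsrc⟩⟩
  · show p.src.shift p.μ = castSite (z' + e p.μ)
    rw [castSite_add_e, hsrc]
  · show p.src.shift p.ν = castSite (z' + e p.ν)
    rw [castSite_add_e, hsrc]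

variable [DecidableEq (PBond P k)]

/-- ★★ **THE JUNCTION (J-c) → (S5)**: let `S = castSite″[lo, hi]` (the box `Λ^{(k)}` of the N12 endpoint, `hbox`) and `T` ANY tree; if the bond variables of the background are within `δ` of `1`
on `boxBonds (lo − 1) (hi + 2)` (operator norm), then the four bond variables of EVERY plaquette meeting a free bond of the chart are within `δ` of `1` — the support-local hypothesis of
`B16Ineq19NearFlatSlice` (free bonds meet `S`: `mem_freeBonds` ∕ `bondsOf`). [cite: Balaban1989LargeFieldII, p.357, p.359; Balaban1989LargeFieldI, p.193] -/
theorem nearFlat_local_hyp_of_boxBonds {lo hi : Fin P.d → ℤ} {S : Set (Site P k)} (hS : S = (castSite '' Set.Icc lo hi : Set (Site P k)))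
    {T : Finset (PBond P k)} (U : GaugeField P k SU2) {δ : ℝ}
    (hU : ∀ b : PBond P k, b ∈ boxBonds (lo - 1) (hi + 2) → ‖((U b : SU2) : Matrix (Fin 2) (Fin 2) ℂ) - 1‖ ≤ δ) (p : Plaq P k)
    (hp : (⟨p.src, p.μ⟩ : PBond P k) ∈ freeBonds S T ∨ (⟨p.src.shift p.μ, p.ν⟩ : PBond P k) ∈ freeBonds S T
        ∨ (⟨p.src.shift p.ν, p.μ⟩ : PBond P k) ∈ freeBonds S T ∨ (⟨p.src, p.ν⟩ : PBond P k) ∈ freeBonds S T) :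
    ‖((U ⟨p.src, p.μ⟩ : SU2) : Matrix (Fin 2) (Fin 2) ℂ) - 1‖ ≤ δ ∧ ‖((U ⟨p.src.shift p.μ, p.ν⟩ : SU2) : Matrix (Fin 2) (Fin 2) ℂ) - 1‖ ≤ δ
      ∧ ‖((U ⟨p.src.shift p.ν, p.μ⟩ : SU2) : Matrix (Fin 2) (Fin 2) ℂ) - 1‖ ≤ δ ∧ ‖((U ⟨p.src, p.ν⟩ : SU2) : Matrix (Fin 2) (Fin 2) ℂ) - 1‖ ≤ δ := by
  subst hS
  -- a free bond meets `S`: one of its two ends is a corner of `p` in the box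
  have hcorner : p.src ∈ (castSite '' Set.Icc lo hi : Set (Site P k)) ∨ p.src.shift p.μ ∈ (castSite '' Set.Icc lo hi : Set (Site P k))
      ∨ p.src.shift p.ν ∈ (castSite '' Set.Icc lo hi : Set (Site P k)) ∨ (p.src.shift p.μ).shift p.ν ∈ (castSite '' Set.Icc lo hi : Set (Site P k))
      ∨ (p.src.shift p.ν).shift p.μ ∈ (castSite '' Set.Icc lo hi : Set (Site P k)) := by
    rcases hp with h | h | h | h
    · rcases (mem_freeBonds.1 h).1 with hs | ht
      · exact Or.inl hs
      · exact Or.inr (Or.inl ht)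
    · rcases (mem_freeBonds.1 h).1 with hs | ht
      · exact Or.inr (Or.inl hs)
      · exact Or.inr (Or.inr (Or.inr (Or.inl ht)))
    · rcases (mem_freeBonds.1 h).1 with hs | ht
      · exact Or.inr (Or.inr (Or.inl hs))
      · exact Or.inr (Or.inr (Or.inr (Or.inr ht)))
    · rcases (mem_freeBonds.1 h).1 with hs | ht
      · exact Or.inl hs
      · exact Or.inr (Or.inr (Or.inl ht))
  obtain ⟨z', hsrc, hlo, hhi⟩ := exists_src_eq_castSite_of_corner_mem p hcorner
  obtain ⟨h1, h2, h3, h4⟩ := plaq_bonds_mem_boxBonds p z' hsrc hlo hhi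
  exact ⟨hU _ h1, hU _ h2, hU _ h3, hU _ h4⟩

/-- The same from the `GaugeGroup` spelling `dist1 (U b) ≤ δ` of (J-c)'s output. [cite: Balaban1989LargeFieldII, p.357; Balaban1985Averaging, (19) p.21] -/
theorem nearFlat_local_hyp_of_boxBonds_dist1 {lo hi : Fin P.d → ℤ} {S : Set (Site P k)} (hS : S = (castSite '' Set.Icc lo hi : Set (Site P k)))
    {T : Finset (PBond P k)} (U : GaugeField P k SU2) {δ : ℝ}
    (hU : ∀ b : PBond P k, b ∈ boxBonds (lo - 1) (hi + 2) → dist1 (U b) ≤ δ) (p : Plaq P k)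
    (hp : (⟨p.src, p.μ⟩ : PBond P k) ∈ freeBonds S T ∨ (⟨p.src.shift p.μ, p.ν⟩ : PBond P k) ∈ freeBonds S T
        ∨ (⟨p.src.shift p.ν, p.μ⟩ : PBond P k) ∈ freeBonds S T ∨ (⟨p.src, p.ν⟩ : PBond P k) ∈ freeBonds S T) :
    ‖((U ⟨p.src, p.μ⟩ : SU2) : Matrix (Fin 2) (Fin 2) ℂ) - 1‖ ≤ δ ∧ ‖((U ⟨p.src.shift p.μ, p.ν⟩ : SU2) : Matrix (Fin 2) (Fin 2) ℂ) - 1‖ ≤ δ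
      ∧ ‖((U ⟨p.src.shift p.ν, p.μ⟩ : SU2) : Matrix (Fin 2) (Fin 2) ℂ) - 1‖ ≤ δ ∧ ‖((U ⟨p.src, p.ν⟩ : SU2) : Matrix (Fin 2) (Fin 2) ℂ) - 1‖ ≤ δ :=
  nearFlat_local_hyp_of_boxBonds hS U (fun b hb => by rw [← dist1_eq_norm_coe_sub_one]; exact hU b hb) p hp

/-! ## §2  The N12 chain's `h17` for the bare action from a `boxBonds` near-flatness letter -/

/-- **THE NEAR-FLAT (1.7) ALONG THE SLICE FROM A BOX LETTER**: with `S = castSite″[lo, hi]`, any tree `T`, a background `U` with `‖U_b − 1‖ ≤ δ` (`δ ≥ 0`) on `boxBonds (lo − 1) (hi + 2)`, and any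
non-wrapping window `box m lo′`: `Σ_{z∈box} Σ_μ Σ_a curl(ιA X)(z)(e₀,μ)² − 64(d−1)δ·‖X‖² ≤ d²∕ds² A(exp(is·ιA X)·U)∣₀`. [cite: Balaban1989LargeFieldII, (1.7) p.358, p.357] -/
theorem curlSq_sub_le_secondVariation_nearFlat_of_boxBonds (h0 : 0 < P.d) (h1 : 1 < P.d) {m : Fin P.d → ℕ} {lo' : Fin P.d → ℤ}
    (hm : ∀ κ, (m κ : ℤ) ≤ P.sitesPerDir k) {lo hi : Fin P.d → ℤ} {S : Set (Site P k)} (hS : S = (castSite '' Set.Icc lo hi : Set (Site P k)))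
    {T : Finset (PBond P k)} (X : GaugeSlice S T (EuclideanSpace ℝ (Fin 3))) (U : GaugeField P k SU2) {δ : ℝ} (hδ0 : 0 ≤ δ)
    (hU : ∀ b : PBond P k, b ∈ boxBonds (lo - 1) (hi + 2) → ‖((U b : SU2) : Matrix (Fin 2) (Fin 2) ℂ) - 1‖ ≤ δ) :
    (∑ z ∈ box m lo', ∑ μ : Fin P.d, ∑ a : Fin 3, curl (fun b : (Fin P.d → ℤ) × Fin P.d => ιA S T X (⟨castSite b.1, b.2⟩ : PBond P k) a) z ⟨0, h0⟩ μ ^ 2)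
        - 64 * ((P.d : ℝ) - 1) * δ * ‖X‖ ^ 2
      ≤ deriv (deriv fun s : ℝ => wilsonAction4 (expMul su2Chart (s • ιA S T X) U)) 0 :=
  curlSq_sub_le_secondVariation_nearFlat_local h0 h1 hm X U hδ0 (nearFlat_local_hyp_of_boxBonds hS U hU)

/-- ★★★ **THE N12 CHAIN'S `h17` LETTER (`B15Prop1OneSidedIneq17Edition` :395 with `f := wilsonAction4`, `γ₀ := 1`, `Cerr := 64(d−1)δ`) FROM A BOX NEAR-FLATNESS LETTER**: with
`S = castSite″[lo, hi]` (the endpoint's `hbox`), any tree `T`, window margins `n_κ + 5 < sitesPerDir k`, and a background `U` with `‖U_b − 1‖ ≤ δ` (`δ ≥ 0`) on `boxBonds (lo − 1) (hi + 2)`: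
`1·(Σ_{z∈box(n+3)(lo−2)} Σ_μ Σ_a curl(ιA X)(z)(e₀,μ)²) − (64(d−1)δ)·‖X‖² ≤ ⟪X, D(∇ sliceFn wilsonAction4 U)(0) X⟫` for every coordinate vector `X`.
[cite: Balaban1989LargeFieldII, (1.7) p.358, p.357, (1.12) p.359] -/
theorem h17_nearFlat_sliceFn_of_boxBonds (h0 : 0 < P.d) (h1 : 1 < P.d) {lo hi : Fin P.d → ℤ} {n : Fin P.d → ℕ} (hN : ∀ κ, (n κ : ℤ) + 5 < P.sitesPerDir k)
    {S : Set (Site P k)} (hS : S = (castSite '' Set.Icc lo hi : Set (Site P k))) {T : Finset (PBond P k)} (U : GaugeField P k SU2) {δ : ℝ} (hδ0 : 0 ≤ δ)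
    (hU : ∀ b : PBond P k, b ∈ boxBonds (lo - 1) (hi + 2) → ‖((U b : SU2) : Matrix (Fin 2) (Fin 2) ℂ) - 1‖ ≤ δ)
    (X : GaugeSlice S T (EuclideanSpace ℝ (Fin 3))) :
    1 * (∑ z ∈ box (fun i => n i + 3) (fun i => lo i - 2), ∑ μ : Fin P.d, ∑ a : Fin 3,
        curl (fun b : (Fin P.d → ℤ) × Fin P.d => ιA S T X (⟨castSite b.1, b.2⟩ : PBond P k) a) z ⟨0, h0⟩ μ ^ 2)
        - (64 * ((P.d : ℝ) - 1) * δ) * ‖X‖ ^ 2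
      ≤ inner ℝ X (fderiv ℝ (rGrad S T (sliceFn S T wilsonAction4 U)) 0 X) :=
  h17_nearFlat_sliceFn_local h0 h1 hN U hδ0 (nearFlat_local_hyp_of_boxBonds hS U hU) X

/-- The same from the `GaugeGroup` spelling `dist1 (U b) ≤ δ` on `boxBonds (lo − 1) (hi + 2)` — (J-c)'s output shape for the gauge-transformed background.
[cite: Balaban1989LargeFieldII, (1.7) p.358, p.357] -/
theorem h17_nearFlat_sliceFn_of_boxBonds_dist1 (h0 : 0 < P.d) (h1 : 1 < P.d) {lo hi : Fin P.d → ℤ} {n : Fin P.d → ℕ} (hN : ∀ κ, (n κ : ℤ) + 5 < P.sitesPerDir k)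
    {S : Set (Site P k)} (hS : S = (castSite '' Set.Icc lo hi : Set (Site P k))) {T : Finset (PBond P k)} (U : GaugeField P k SU2) {δ : ℝ} (hδ0 : 0 ≤ δ)
    (hU : ∀ b : PBond P k, b ∈ boxBonds (lo - 1) (hi + 2) → dist1 (U b) ≤ δ)
    (X : GaugeSlice S T (EuclideanSpace ℝ (Fin 3))) :
    1 * (∑ z ∈ box (fun i => n i + 3) (fun i => lo i - 2), ∑ μ : Fin P.d, ∑ a : Fin 3,
        curl (fun b : (Fin P.d → ℤ) × Fin P.d => ιA S T X (⟨castSite b.1, b.2⟩ : PBond P k) a) z ⟨0, h0⟩ μ ^ 2)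
        - (64 * ((P.d : ℝ) - 1) * δ) * ‖X‖ ^ 2
      ≤ inner ℝ X (fderiv ℝ (rGrad S T (sliceFn S T wilsonAction4 U)) 0 X) :=
  h17_nearFlat_sliceFn_of_boxBonds h0 h1 hN hS U hδ0 (fun b hb => by rw [← dist1_eq_norm_coe_sub_one]; exact hU b hb) X

end Literature.MathematicalPhysics.QuantumFieldTheory.Balaban1983to89.B16Ineq19NearFlatSliceBox

end
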